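import Summits.CriticalPhenomena.PercolationContinuityZ3.Theorems.SahiMasterFamilyUCCertSixD
import Summits.CriticalPhenomena.PercolationContinuityZ3.Theorems.SahiMasterFamilyGHBridge

/-!
# `F^{UC}(6)` and `(UC-hull)_6` — Sahi positivity of order 6 on the linear union-closed relaxation, by a kernel-checked certificate

Unit `prim-masterthm-p4` (gen 16; crux anchor stmt-CriticalPhenomena-4575, helper work; memo
`run/shared/lean/prim/prim-masterthm/prim-masterthm-p4/P4-GEN16-REPORT.md` §7; certificate: COLUMN GENERATION kit j138927 (products of a partial-partition monomial with at most two atoms `β_S`, `1 − β_S`,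
`1 + (m−1)β_B − Σ β_{A_i}` (m ≤ 5) plus box-third triples, `S_6`-symmetrised, exact vertex; data files `…UCCertSixR`, `…UCCertSixD`);
data generator `code-g16/gen_uccert.py`, independent exact re-verification `code-g16/cert_tools.py`).
The unsymmetrised certificate `Q` has 83 products with integer weights (`M = 3176656992`); `R = Q − 3176656992·Φ_6` has 1437 monomials in
197 `S_6`-orbit classes, all class sums zero.  The kernel evaluates the four pieces of the orbit-basis check
(`PhiCert.fucNonneg_of_orbitPiecesU` of `…UCCert`) by `decide`.
* **`fucNonneg_six : PhiCert.FUCNonneg 6`** — `Φ_6 ≥ 0` whenever `0 ≤ β ≤ 1`, `β_univ = 1` and the pairwise-covering inequalities hold.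
* **`ucHullNonneg_six : GHConjecture.UCHullNonneg 6`** — `(UC-hull)_6`; hence `(GH)_6` and PC-6 again (`gSystemNonneg_six'`, `pcNonneg_six'`).
HONEST FRAMING: `F^{UC}(n)` / `(UC-hull)_n` OPEN for `n ≥ 7`; Sahi's `C_k`, (GH)_k = PC-k (k ≥ 8) and the master theorem remain OPEN.
Axioms standard. [this work]
-/

set_option autoImplicit false

namespace Summit.CriticalPhenomena.PercolationContinuityZ3.Theorems

namespace PhiCert

/-- **`F^{UC}(6)` holds** (kernel theorem, standard axioms). [this work] -/
theorem fucNonneg_six : FUCNonneg 6 :=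
  fucNonneg_of_orbitPiecesU 5 3176656992 (by norm_num) ucCert_six ucD_six ucRD_six ucCheckT_six ucDataD_six ucNormR_six ucReconD_six

/-- **`(UC-hull)_6` holds.** [this work] -/
theorem ucHullNonneg_six : GHConjecture.UCHullNonneg 6 :=
  ucHullNonneg_of_fucNonneg fucNonneg_six

/-- `(GH)_6` through `(UC-hull)_6`. [this work] -/
theorem gSystemNonneg_six' : GHConjecture.GSystemNonneg 6 :=
  GHConjecture.gSystemNonneg_of_ucHullNonneg ucHullNonneg_six

/-- PC-6 through `(UC-hull)_6` and `…GHBridge`. [this work] -/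
theorem pcNonneg_six' : GHBridge.PCNonneg 6 :=
  GHBridge.pcNonneg_of_ucHullNonneg ucHullNonneg_six

end PhiCert

end Summit.CriticalPhenomena.PercolationContinuityZ3.Theorems
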